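import Summits.Ventures.YMGap.RobustBall.RobustSlabPeeling
import Literature.MathematicalPhysics.QuantumFieldTheory.QuasiLocalGaugePerturbationKernels
import HarnessLib

/-!
# Robust ball (Y2), area-law side, part 3 — the ROBUST Durhuus–Fröhlich slab criterion for perturbed actions

HONEST FRAMING: venture file of the cell `pub-ymgap` (QuantumFields programme), track ROBUST-BALL.  MAIN THEOREM of the area-law
side's reduction: for the lattice `SU(N)` gauge theory on the torus `(ℤ/L)^{n+1}` with a PERTURBED action `Nβ S_W + W` — `W` any
bounded measurable function of the links which (HCentre) is invariant under the centre rotation of the vertical links of every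
coordinate slab and (HLoc) has vertical range `m` seen by the slabs (part 2) — boundary- and rest-uniform exponential clustering of the
PERTURBED slab laws (`hcov`, the robust slab door's output, with constants `C₁, C₂`) implies Wilson's AREA LAW for the perturbed
expectation of every rectangular `R × T` loop with `2R, 2T ≤ L`:
`|⟨W_{R×T}⟩_{Nβ,W}| ≤ max(N, e^{(C₂/2m) M₀²}) · e^{-(C₂/2m) RT}`, `M₀ = 2 log max(4N^{2m+2}… ,1)/C₂` EXPLICIT — the constants depend on
`(N, m, C₁, C₂)` only, NOT on `L`, `β` or `W`: this is what makes the area law UNIFORM on a ball of perturbations once the door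
delivers `(C₁, C₂)` uniformly on the ball.  Corollary in the vocabulary of the tree's `QuasiLocalGaugePerturbation`
(`W.expectation (fundamentalRep (Fin N)) (Nβ) (wilsonLoop …)`).  At `W = 0`, `m = 1` this is CNS25 Thm 2.3 / DF80 as discharged in
the tree (`durhuusFrohlich_areaLaw_of_slabClustering_holds`), with the same rate up to the factor `1/m`.
Strong-coupling finite-lattice statement; nothing about the continuum, a mass gap, or Clay.

References: Cao–Nissim–Sheffield arXiv:2509.04688v2 Thm 2.3 and §2; Durhuus–Fröhlich CMP 75 (1980) Thms 1.2–1.3.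
-/

noncomputable section

open MeasureTheory
open Literature.MathematicalPhysics.QuantumLattice (fundamentalRep continuous_fundamentalRep fundamentalRep_apply)
open Literature.MathematicalPhysics.QuantumFieldTheory
open Literature.MathematicalPhysics.QuantumFieldTheory.DurhuusFrohlich

namespace Summit.Ventures.YMGap.RobustBall

variable {n L N : ℕ}

section Assembly

variable [NeZero L] {W : GaugeConfig (n + 1) L (SU N) → ℝ}


open ProbabilityTheory

omit [NeZero L] in
/-- `|W_γ(U)| ≤ 1`. [folklore] -/
theorem abs_wilsonLoop_le_one' {d : ℕ} (U : GaugeConfig d L (SU N)) (x : Site d L) (i j : Fin d) (R T : ℕ) :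
    |wilsonLoop (fundamentalRep (Fin N)) x i j R T U| ≤ 1 := by
  rw [wilsonLoop, fundamentalRep_apply, abs_mul]
  rcases Nat.eq_zero_or_pos N with hN | hN
  · subst hN; simp
  · have hNr : (0 : ℝ) < N := by exact_mod_cast hN
    rw [abs_inv, Nat.abs_cast, inv_mul_le_iff₀ hNr, mul_one]
    set M := ((rectangleHolonomy U x i j R T : SU N) : Matrix (Fin N) (Fin N) ℂ)
    calc |(M.trace).re| ≤ ‖M.trace‖ := Complex.abs_re_le_norm _
      _ = ‖∑ a, M a a‖ := by rw [Matrix.trace]; rfl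
      _ ≤ ∑ a, ‖M a a‖ := norm_sum_le _ _
      _ ≤ ∑ _a : Fin N, (1 : ℝ) := Finset.sum_le_sum fun a _ => norm_entry_le _ a a
      _ = N := by simp

/-- **`|⟨W_γ⟩_{Nβ,W}| ≤ 1`** for the perturbed expectation (`|W_γ| ≤ 1` pointwise, positive weight). [folklore] -/
theorem abs_loopRatio_le_one (β : ℝ) (hWm : Measurable W) (hWb : ∃ C, ∀ U, |W U| ≤ C)
    (x : Site (n + 1) L) (i j : Fin (n + 1)) (R T : ℕ) :
    |(∫ U, wilsonLoop (fundamentalRep (Fin N)) x i j R T U * weightW N β W U ∂(linkMeasure n L N)) /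
        ∫ U, weightW N β W U ∂(linkMeasure n L N)| ≤ 1 := by
  have hZ := integral_weightW_pos (n := n) (L := L) (N := N) β hWm hWb
  rw [abs_div, abs_of_pos hZ, div_le_one hZ]
  calc |∫ U, wilsonLoop (fundamentalRep (Fin N)) x i j R T U * weightW N β W U ∂(linkMeasure n L N)|
      ≤ ∫ U, |wilsonLoop (fundamentalRep (Fin N)) x i j R T U * weightW N β W U| ∂(linkMeasure n L N) :=
        abs_integral_le_integral_abs
    _ ≤ ∫ U, weightW N β W U ∂(linkMeasure n L N) := by
        refine integral_mono_of_nonneg (ae_of_all _ fun U => abs_nonneg _) (integrable_weightW β hWm hWb)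
          (ae_of_all _ fun U => ?_)
        dsimp only
        rw [abs_mul, abs_of_pos (weightW_pos W β U)]
        exact mul_le_of_le_one_left (weightW_pos W β U).le (abs_wilsonLoop_le_one' U x i j R T)

omit [NeZero L] in
/-- The slice distance between the two legs: `d(x̄ + R e_k, x̄) = R` for `2R ≤ L`. [folklore] -/
theorem torusGraphDist_add_single' (x : Site n L) (k : Fin n) {R : ℕ} (hR : 2 * R ≤ L) :
    torusGraphDist (x + Pi.single k (R : ZMod L)) x = R := by
  unfold torusGraphDist
  have hval : ((R : ℕ) : ZMod L).valMinAbs = R := ZMod.valMinAbs_natCast_of_le_half (by omega)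
  rw [Finset.sum_eq_single k]
  · simp [hval]
  · intro k' _ hk'; simp [hk']
  · intro h; exact absurd (Finset.mem_univ k) h

omit [NeZero L] in
/-- A line holonomy in direction `i` is horizontal for every `v ≠ i`. [folklore] -/
theorem isHorizontal_leg' {v i : Fin (n + 1)} (hvi : i ≠ v) (t : ZMod L) (q : Site n L) (R : ℕ) :
    IsHorizontal (N := N) v fun U => ((leg i t q R U : SU N) : Matrix (Fin N) (Fin N) ℂ) := by
  intro U U' h
  show ((leg i t q R U : SU N) : Matrix (Fin N) (Fin N) ℂ) = ((leg i t q R U' : SU N) : Matrix (Fin N) (Fin N) ℂ)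
  rw [leg_congr' i t q R fun s _ => h _ hvi]

omit [NeZero L] in
/-- The adjoint of a line holonomy in direction `i` is horizontal for every `v ≠ i`. [folklore] -/
theorem isHorizontal_star_leg' {v i : Fin (n + 1)} (hvi : i ≠ v) (t : ZMod L) (q : Site n L) (R : ℕ) :
    IsHorizontal (N := N) v fun U => star ((leg i t q R U : SU N) : Matrix (Fin N) (Fin N) ℂ) := by
  intro U U' h
  show star ((leg i t q R U : SU N) : Matrix (Fin N) (Fin N) ℂ) =
    star ((leg i t q R U' : SU N) : Matrix (Fin N) (Fin N) ℂ)
  rw [leg_congr' i t q R fun s _ => h _ hvi]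

/-- **The main bound, perturbed** (robust version of CNS §2, eq. before (area-law-intermediate)): under (HCentre) and (HLoc) in
the vertical direction `j` and rest-uniform clustering of the perturbed `j`-slab laws, for every loop with vertical side `T`,
`2T ≤ L`, and horizontal separation `R`, `2R ≤ L`:
`|⟨W_{R×T}⟩_{Nβ,W}| ≤ N · peelBound N m (4C₁e^{-C₂R}) 0 T  (= N · N^{2T} (4C₁e^{-C₂R})^{⌈T/m⌉})`.
[cite: CaoNissimSheffield2025dynamical, Theorem 2.3] -/
theorem abs_loopRatio_le_peelBound (hN : 2 ≤ N) (β : ℝ) (hWm : Measurable W) (hWb : ∃ C, ∀ U, |W U| ≤ C)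
    {m : ℕ} (hm : 1 ≤ m) {j : Fin (n + 1)} (hloc : HasVerticalRange W j m)
    (hWc : ∀ (t : ZMod L) U, W (slabRotate (centre N (by omega)) j t U) = W U) {C₁ C₂ : ℝ}
    (hcov : ∀ (t : ZMod L) (r : {e : Edge (n + 1) L // ¬ IsSlab j t e} → SU N) (x y : Site n L) (i j' k l : Fin N)
      (φ ψ : ℂ → ℝ), (φ = Complex.re ∨ φ = Complex.im) → (ψ = Complex.re ∨ ψ = Complex.im) →
        |cov[fun Q => φ ((Q x : Matrix (Fin N) (Fin N) ℂ) i j'),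
            fun Q => ψ ((((Q y)⁻¹ : Matrix.specialUnitaryGroup (Fin N) ℂ) :
              Matrix (Fin N) (Fin N) ℂ) k l); slabLawW j t β W r]| ≤ C₁ * Real.exp (-C₂ * torusGraphDist x y))
    (x : Site (n + 1) L) {i : Fin (n + 1)} (hij : i ≠ j) {R T : ℕ} (hRL : 2 * R ≤ L) (hTL : 2 * T ≤ L) :
    |(∫ U, wilsonLoop (fundamentalRep (Fin N)) x i j R T U * weightW N β W U ∂(linkMeasure n L N)) /
        ∫ U, weightW N β W U ∂(linkMeasure n L N)| ≤
      N * peelBound N m (4 * C₁ * Real.exp (-C₂ * R)) 0 T := by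
  obtain ⟨ī, hī⟩ := Fin.exists_succAbove_eq hij
  set p : Site n L := rem j x + Pi.single ī (R : ZMod L) with hp
  set p' : Site n L := rem j x with hp'
  set A : GaugeConfig (n + 1) L (SU N) → Matrix (Fin N) (Fin N) ℂ :=
    fun U => ((leg i (x i) (rem i x) R U : SU N) : Matrix (Fin N) (Fin N) ℂ) with hA
  set B : GaugeConfig (n + 1) L (SU N) → Matrix (Fin N) (Fin N) ℂ :=
    fun U => star ((leg i ((x + Pi.single j ((T : ℕ) : ZMod L) : Site (n + 1) L) i)
      (rem i (x + Pi.single j ((T : ℕ) : ZMod L))) R U : SU N) : Matrix (Fin N) (Fin N) ℂ) with hB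
  have hdist : torusGraphDist p p' = R := by rw [hp, hp']; exact torusGraphDist_add_single' _ ī hRL
  -- the perturbed slab two-point bound, for every height and every rest
  set ε : ℝ := 4 * C₁ * Real.exp (-C₂ * R) with hε
  have hεb : ∀ (t : ZMod L) (r : {e : Edge (n + 1) L // ¬ IsSlab j t e} → SU N) (a b c d : Fin N),
      ‖∫ Q, ((Q p : SU N) : Matrix (Fin N) (Fin N) ℂ) a b * (((Q p')⁻¹ : SU N) : Matrix (Fin N) (Fin N) ℂ) c d
        ∂(slabLawW j t β W r)‖ ≤ ε := by
    intro t r a b c d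
    have h := norm_integral_entry_mul_inv_entry_slabLawW_le (n := n) (L := L) hN j t β hWm hWb (hWc t) r p p'
      (C := C₁ * Real.exp (-C₂ * R)) (fun i' j' k l φ ψ hφ hψ => by
        have := hcov t r p p' i' j' k l φ ψ hφ hψ; rwa [hdist] at this) a b c d
    rw [hε]; linarith
  have hε0 : 0 ≤ ε := by
    have i0 : Fin N := ⟨0, by omega⟩
    exact (norm_nonneg _).trans (hεb 0 (fun _ => 1) i0 i0 i0 i0)
  -- the sparse peeling induction, from the state `(0, T)` with `K = 1`
  have hmain := norm_integral_loopObs_le_W (N := N) j (x j) p p' β hWm hWb hm hloc hε0 hεb T hTL 0 (by omega) 1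
    zero_le_one A B (fun a b => measurable_coe_leg_entry' i _ _ R a b)
    (fun a b => measurable_star_coe_leg_entry' i _ _ R a b)
    (fun U a b => norm_entry_le _ a b) (fun U a b => norm_star_entry_le' _ a b)
    (isHorizontal_leg' hij _ _ R) (IsHorizontal.seesOnlyAbove (isHorizontal_star_leg' (N := N) hij _ _ R) _ _)
  -- the perturbed expectation as a ratio of integrals
  have hW : ∀ U, wilsonLoop (fundamentalRep (Fin N)) x i j R T U =
      (N : ℝ)⁻¹ * (loopObs j (x j) p p' T A B U).re := fun U => wilsonLoop_eq_loopObs x hī R T U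
  set Z := ∫ U, weightW N β W U ∂(linkMeasure n L N) with hZ
  have hZpos : 0 < Z := integral_weightW_pos (n := n) (L := L) (N := N) β hWm hWb
  have hmeas : Measurable (loopObs j (x j) p p' T A B) :=
    measurable_loopObs j (x j) p p' T (fun a b => measurable_coe_leg_entry' i _ _ R a b)
      (fun a b => measurable_star_coe_leg_entry' i _ _ R a b)
  have hbd : ∀ U, ‖loopObs j (x j) p p' T A B U‖ ≤ (N : ℝ) ^ 3 * (N * 1) := fun U =>
    norm_loopObs_le j (x j) p p' T (fun U a b => norm_entry_le _ a b) (fun U a b => norm_star_entry_le' _ a b) U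
  have hint : Integrable (fun U => (weightW N β W U : ℂ) * loopObs j (x j) p p' T A B U) (linkMeasure n L N) :=
    integrable_weightW_mul β hWm hWb hmeas hbd
  have hnum : ∫ U, wilsonLoop (fundamentalRep (Fin N)) x i j R T U * weightW N β W U ∂(linkMeasure n L N) =
      (N : ℝ)⁻¹ * (∫ U, (weightW N β W U : ℂ) * loopObs j (x j) p p' T A B U ∂(linkMeasure n L N)).re := by
    have h1 := integral_re hint
    simp only [RCLike.re_to_complex, Complex.re_ofReal_mul] at h1
    rw [← h1, ← integral_const_mul]
    refine integral_congr_ae (ae_of_all _ fun U => ?_)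
    simp only [hW]
    ring
  change |(∫ U, wilsonLoop (fundamentalRep (Fin N)) x i j R T U * weightW N β W U ∂(linkMeasure n L N)) / Z| ≤ _
  rw [hnum, abs_div, abs_of_pos hZpos, div_le_iff₀ hZpos, abs_mul, abs_inv, Nat.abs_cast]
  have hNr : (0 : ℝ) < N := by exact_mod_cast (show 0 < N by omega)
  calc (N : ℝ)⁻¹ * |(∫ U, (weightW N β W U : ℂ) * loopObs j (x j) p p' T A B U ∂(linkMeasure n L N)).re|
      ≤ (N : ℝ)⁻¹ * ‖∫ U, (weightW N β W U : ℂ) * loopObs j (x j) p p' T A B U ∂(linkMeasure n L N)‖ :=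
        mul_le_mul_of_nonneg_left (Complex.abs_re_le_norm _) (inv_nonneg.2 hNr.le)
    _ ≤ (N : ℝ)⁻¹ * ((N : ℝ) ^ 2 * 1 * peelBound N m ε 0 T * Z) :=
        mul_le_mul_of_nonneg_left hmain (inv_nonneg.2 hNr.le)
    _ = ((N : ℝ)⁻¹ * N) * N * peelBound N m ε 0 T * Z := by ring
    _ = N * peelBound N m ε 0 T * Z := by rw [inv_mul_cancel₀ hNr.ne', one_mul]

/-- Exponent bookkeeping: for `a ≤ K₀`, `1 ≤ K₀` and `R ≥ 2 log K₀ / C₂`, `(a e^{-C₂R})^c ≤ e^{-(C₂/2) R c}`. [folklore] -/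
theorem pow_mul_exp_le' {a K₀ C₂ : ℝ} (ha : 0 ≤ a) (haK : a ≤ K₀) (hK₀ : 1 ≤ K₀) (hC₂ : 0 < C₂) {R : ℕ}
    (hR : 2 * Real.log K₀ / C₂ ≤ R) (c : ℕ) :
    (a * Real.exp (-C₂ * R)) ^ c ≤ Real.exp (-(C₂ / 2) * ((R : ℝ) * c)) := by
  have hK₀pos : 0 < K₀ := lt_of_lt_of_le one_pos hK₀
  have h1 : (a * Real.exp (-C₂ * R)) ^ c ≤ (K₀ * Real.exp (-C₂ * R)) ^ c :=
    pow_le_pow_left₀ (mul_nonneg ha (Real.exp_pos _).le) (mul_le_mul_of_nonneg_right haK (Real.exp_pos _).le) c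
  refine h1.trans ?_
  rw [← Real.exp_log hK₀pos, ← Real.exp_add, ← Real.exp_nat_mul]
  refine Real.exp_le_exp.2 ?_
  have h2 : 2 * Real.log K₀ ≤ (R : ℝ) * C₂ := (div_le_iff₀ hC₂).1 hR
  have hc : (0 : ℝ) ≤ c := Nat.cast_nonneg c
  nlinarith

/-- **The sparse-peeling constant decays in the AREA**: with `ε = 4C₁e^{-C₂R}`, `K₀ = max((N²)^m · 4C₁, 1)` and
`R ≥ 2 log K₀ / C₂`:  `peelBound N m ε 0 T ≤ e^{-(C₂/(2m)) R T}` — because at least `T/m` slabs are integrated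
(`le_mul_peelCount`) and each contributes `(N²)^m ε ≤ e^{-(C₂/2)R}`. [folklore] -/
theorem peelBound_le_exp_area (hN : 1 ≤ N) {m : ℕ} (hm : 1 ≤ m) {C₁ C₂ : ℝ} (hC₁ : 0 ≤ C₁) (hC₂ : 0 < C₂) {R : ℕ}
    (hR : 2 * Real.log (max (((N : ℝ) ^ 2) ^ m * (4 * C₁)) 1) / C₂ ≤ R) (T : ℕ) :
    peelBound N m (4 * C₁ * Real.exp (-C₂ * R)) 0 T ≤ Real.exp (-(C₂ / (2 * m)) * ((R : ℝ) * T)) := by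
  set c := peelCount m 0 T with hc
  have hTc : T ≤ m * c := by have := le_mul_peelCount m T 0 (by omega); omega
  have hN2 : (1 : ℝ) ≤ (N : ℝ) ^ 2 := one_le_pow₀ (by exact_mod_cast hN)
  rw [peelBound_eq]
  -- (N²)^T ε^c ≤ ((N²)^m)^c ε^c = ((N²)^m · 4C₁ · e^{-C₂R})^c
  have hpow : ((N : ℝ) ^ 2) ^ T ≤ (((N : ℝ) ^ 2) ^ m) ^ c := by
    rw [← pow_mul ((N : ℝ) ^ 2) m c]; exact pow_le_pow_right₀ hN2 hTc
  have h1 : ((N : ℝ) ^ 2) ^ T * (4 * C₁ * Real.exp (-C₂ * R)) ^ c ≤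
      (((N : ℝ) ^ 2) ^ m * (4 * C₁) * Real.exp (-C₂ * R)) ^ c :=
    calc ((N : ℝ) ^ 2) ^ T * (4 * C₁ * Real.exp (-C₂ * R)) ^ c
        ≤ (((N : ℝ) ^ 2) ^ m) ^ c * (4 * C₁ * Real.exp (-C₂ * R)) ^ c :=
          mul_le_mul_of_nonneg_right hpow (by positivity)
      _ = (((N : ℝ) ^ 2) ^ m * (4 * C₁) * Real.exp (-C₂ * R)) ^ c := by rw [← mul_pow]; ring
  refine h1.trans ?_
  have h2 := pow_mul_exp_le' (C₂ := C₂) (R := R) (by positivity) (le_max_left _ 1) (le_max_right _ _) hC₂ hR c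
  refine h2.trans (Real.exp_le_exp.2 ?_)
  -- -(C₂/2) R c ≤ -(C₂/(2m)) R T  since  T ≤ m c
  have hmr : (0 : ℝ) < m := by exact_mod_cast (show 0 < m by omega)
  have hTc' : (T : ℝ) ≤ (m : ℝ) * c := by exact_mod_cast hTc
  have hR0 : (0 : ℝ) ≤ R := Nat.cast_nonneg R
  rw [show -(C₂ / (2 * m)) * ((R : ℝ) * T) = -(C₂ / 2) * (R * (T / m)) by field_simp; try ring]
  have : (R : ℝ) * (T / m) ≤ R * c := mul_le_mul_of_nonneg_left ((div_le_iff₀ hmr).2 (by linarith)) hR0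
  nlinarith

/-- **ROBUST DURHUUS–FRÖHLICH SLAB CRITERION (perturbed actions, explicit constants).**  Let `N ≥ 2`, `β ∈ ℝ`, and let
`W : GaugeConfig (n+1) L (SU N) → ℝ` be bounded measurable, invariant under the centre rotation of the vertical links of every
coordinate slab (HCentre), with vertical range `m ≥ 1` seen by the slabs in every direction (HLoc).  Suppose the perturbed slab laws
cluster, uniformly in the direction, the height and the off-slab links: `|Cov(φ(Q_x)_{ij}, ψ(Q_y⁻¹)_{kl})| ≤ C₁ e^{-C₂ d(x,y)}`, `C₂ > 0`.
Then for every rectangular `R × T` loop in a coordinate plane with `2R, 2T ≤ L`: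
`|⟨W_{R×T}⟩_{Nβ,W}| ≤ max(N, e^{(C₂/2m) M₀²}) · e^{-(C₂/2m) R T}`,  `M₀ = 2 log max((N²)^m·4C₁, 1) / C₂`,
where `⟨F⟩_{Nβ,W} = ∫ F e^{-NβS_W-W} / ∫ e^{-NβS_W-W}`.  The constants do not depend on `L`, `β`, `W`.
[cite: CaoNissimSheffield2025dynamical, Theorem 2.3] -/
theorem robust_slab_criterion (hN : 2 ≤ N) (β : ℝ) (hWm : Measurable W) (hWb : ∃ C, ∀ U, |W U| ≤ C)
    {m : ℕ} (hm : 1 ≤ m) (hloc : ∀ v : Fin (n + 1), HasVerticalRange W v m)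
    (hWc : ∀ (v : Fin (n + 1)) (t : ZMod L) U, W (slabRotate (centre N (by omega)) v t U) = W U)
    {C₁ C₂ : ℝ} (hC₂ : 0 < C₂)
    (hcov : ∀ (v : Fin (n + 1)) (t : ZMod L) (r : {e : Edge (n + 1) L // ¬ IsSlab v t e} → SU N) (x y : Site n L)
      (i j k l : Fin N) (φ ψ : ℂ → ℝ), (φ = Complex.re ∨ φ = Complex.im) → (ψ = Complex.re ∨ ψ = Complex.im) →
        |cov[fun Q => φ ((Q x : Matrix (Fin N) (Fin N) ℂ) i j),
            fun Q => ψ ((((Q y)⁻¹ : Matrix.specialUnitaryGroup (Fin N) ℂ) :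
              Matrix (Fin N) (Fin N) ℂ) k l); slabLawW v t β W r]| ≤ C₁ * Real.exp (-C₂ * torusGraphDist x y))
    (x : Site (n + 1) L) {i j : Fin (n + 1)} (hij : i ≠ j) {R T : ℕ} (hRL : 2 * R ≤ L) (hTL : 2 * T ≤ L) :
    |(∫ U, wilsonLoop (fundamentalRep (Fin N)) x i j R T U * weightW N β W U ∂(linkMeasure n L N)) /
        ∫ U, weightW N β W U ∂(linkMeasure n L N)| ≤
      max (N : ℝ) (Real.exp (C₂ / (2 * m) * (2 * Real.log (max (((N : ℝ) ^ 2) ^ m * (4 * C₁)) 1) / C₂) ^ 2)) *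
        Real.exp (-(C₂ / (2 * m)) * ((R : ℝ) * T)) := by
  -- `0 ≤ C₁` (the hypothesis at a point)
  have i0 : Fin N := ⟨0, by omega⟩
  have hC₁ : 0 ≤ C₁ := by
    have h := hcov j 0 (fun _ => 1) (fun _ => 0) (fun _ => 0) i0 i0 i0 i0 Complex.re Complex.re (Or.inl rfl) (Or.inl rfl)
    have h' : 0 ≤ C₁ * Real.exp (-C₂ * torusGraphDist (n := n) (L := L) (fun _ => 0) (fun _ => 0)) :=
      (abs_nonneg _).trans h
    exact (mul_nonneg_iff_of_pos_right (Real.exp_pos _)).1 h'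
  set M₀ : ℝ := 2 * Real.log (max (((N : ℝ) ^ 2) ^ m * (4 * C₁)) 1) / C₂ with hM₀
  have hM₀ : 0 ≤ M₀ := div_nonneg (mul_nonneg two_pos.le (Real.log_nonneg (le_max_right _ _))) hC₂.le
  have hNr : (1 : ℝ) ≤ N := by exact_mod_cast (show 1 ≤ N by omega)
  have hrate : 0 < C₂ / (2 * m) := div_pos hC₂ (by exact_mod_cast (show 0 < 2 * m by omega))
  -- the two oriented bounds
  have hb1 : M₀ ≤ R → |(∫ U, wilsonLoop (fundamentalRep (Fin N)) x i j R T U * weightW N β W U ∂(linkMeasure n L N)) /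
      ∫ U, weightW N β W U ∂(linkMeasure n L N)| ≤ N * Real.exp (-(C₂ / (2 * m)) * ((R : ℝ) * T)) := by
    intro hMR
    refine (abs_loopRatio_le_peelBound hN β hWm hWb hm (hloc j) (hWc j) (hcov j) x hij hRL hTL).trans ?_
    exact mul_le_mul_of_nonneg_left (peelBound_le_exp_area (by omega) hm hC₁ hC₂ hMR T) (by positivity)
  have hb2 : M₀ ≤ T → |(∫ U, wilsonLoop (fundamentalRep (Fin N)) x i j R T U * weightW N β W U ∂(linkMeasure n L N)) /
      ∫ U, weightW N β W U ∂(linkMeasure n L N)| ≤ N * Real.exp (-(C₂ / (2 * m)) * ((R : ℝ) * T)) := by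
    intro hMT
    have hswap : wilsonLoop (L := L) (fundamentalRep (Fin N)) x i j R T =
        wilsonLoop (fundamentalRep (Fin N)) x j i T R := by
      funext U; exact (wilsonLoop_swap U x i j R T).symm
    rw [hswap]
    refine (abs_loopRatio_le_peelBound hN β hWm hWb hm (hloc i) (hWc i) (hcov i) x hij.symm hTL hRL).trans ?_
    have h := peelBound_le_exp_area (by omega : 1 ≤ N) hm hC₁ hC₂ hMT R
    rw [show ((T : ℝ) * R) = (R : ℝ) * T by ring] at h
    exact mul_le_mul_of_nonneg_left h (by positivity)
  -- case analysis
  by_cases hMR : M₀ ≤ R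
  · exact (hb1 hMR).trans (mul_le_mul_of_nonneg_right (le_max_left _ _) (Real.exp_pos _).le)
  by_cases hMT : M₀ ≤ T
  · exact (hb2 hMT).trans (mul_le_mul_of_nonneg_right (le_max_left _ _) (Real.exp_pos _).le)
  -- both sides short: `|⟨W⟩| ≤ 1 ≤ e^{rate M₀²} e^{-rate RT}`
  simp only [not_le] at hMR hMT
  have hRT : (R : ℝ) * T ≤ M₀ ^ 2 := by
    rw [sq]; exact mul_le_mul hMR.le hMT.le (Nat.cast_nonneg T) hM₀
  calc |(∫ U, wilsonLoop (fundamentalRep (Fin N)) x i j R T U * weightW N β W U ∂(linkMeasure n L N)) /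
        ∫ U, weightW N β W U ∂(linkMeasure n L N)|
      ≤ 1 := abs_loopRatio_le_one β hWm hWb x i j R T
    _ ≤ Real.exp (C₂ / (2 * m) * M₀ ^ 2) * Real.exp (-(C₂ / (2 * m)) * ((R : ℝ) * T)) := by
        rw [← Real.exp_add]
        exact Real.one_le_exp (by nlinarith)
    _ ≤ max (N : ℝ) (Real.exp (C₂ / (2 * m) * M₀ ^ 2)) * Real.exp (-(C₂ / (2 * m)) * ((R : ℝ) * T)) :=
        mul_le_mul_of_nonneg_right (le_max_right _ _) (Real.exp_pos _).le

end Assembly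

/-! ### The criterion in the vocabulary of the tree's quasi-local gauge perturbations -/

section QuasiLocal

variable [NeZero L]


open ProbabilityTheory

/-- **Perturbed expectations as Gibbs averages**: for a quasi-local gauge perturbation `W` of the `SU(N)` Wilson action at tree
coupling `Nβ`, `⟨F⟩ = ∫ F dμ_{Nβ,W} = ∫ F e^{-NβS_W - W} / ∫ e^{-NβS_W - W}` — the ratio bounded by `robust_slab_criterion` with
`W ↦ W.total`. [folklore] -/
theorem expectation_eq_loopRatio {b : ℕ} (W : QuasiLocalGaugePerturbation (n + 1) L (SU N) b) (β : ℝ)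
    (F : GaugeConfig (n + 1) L (SU N) → ℝ) :
    W.expectation (fundamentalRep (Fin N)) ((N : ℝ) * β) F =
      (∫ U, F U * weightW N β W.total U ∂(linkMeasure n L N)) / ∫ U, weightW N β W.total U ∂(linkMeasure n L N) := by
  rw [QuasiLocalGaugePerturbation.expectation,
    QuasiLocalGaugePerturbation.perturbedMeasure_eq_tilted (fundamentalRep (Fin N)) (continuous_fundamentalRep (Fin N)) _ W,
    integral_tilted]
  simp only [smul_eq_mul]
  rw [div_eq_inv_mul, ← integral_const_mul]
  refine integral_congr_ae (ae_of_all _ fun U => ?_)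
  simp only [weightW]
  ring

/-- **ROBUST DURHUUS–FRÖHLICH SLAB CRITERION for quasi-local gauge perturbations** (`QuasiLocalGaugePerturbation`, the tree's
class; the robust ball `ClusterDomain` is a sub-family): (HCentre) + (HLoc, vertical range `m`) for `W.total` + rest-uniform
clustering of the perturbed slab laws ⇒ `|⟨W_{R×T}⟩_{μ_{Nβ,W}}| ≤ max(N, e^{(C₂/2m)M₀²}) e^{-(C₂/2m)RT}` for all loops with
`2R, 2T ≤ L`, constants independent of `L`, `β`, `W`. [cite: CaoNissimSheffield2025dynamical, Theorem 2.3] -/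
theorem robust_slab_criterion_quasiLocal (hN : 2 ≤ N) (β : ℝ) {b : ℕ}
    (W : QuasiLocalGaugePerturbation (n + 1) L (SU N) b) {m : ℕ} (hm : 1 ≤ m)
    (hloc : ∀ v : Fin (n + 1), HasVerticalRange W.total v m)
    (hWc : ∀ (v : Fin (n + 1)) (t : ZMod L) U, W.total (slabRotate (centre N (by omega)) v t U) = W.total U)
    {C₁ C₂ : ℝ} (hC₂ : 0 < C₂)
    (hcov : ∀ (v : Fin (n + 1)) (t : ZMod L) (r : {e : Edge (n + 1) L // ¬ IsSlab v t e} → SU N) (x y : Site n L)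
      (i j k l : Fin N) (φ ψ : ℂ → ℝ), (φ = Complex.re ∨ φ = Complex.im) → (ψ = Complex.re ∨ ψ = Complex.im) →
        |cov[fun Q => φ ((Q x : Matrix (Fin N) (Fin N) ℂ) i j),
            fun Q => ψ ((((Q y)⁻¹ : Matrix.specialUnitaryGroup (Fin N) ℂ) :
              Matrix (Fin N) (Fin N) ℂ) k l); slabLawW v t β W.total r]| ≤ C₁ * Real.exp (-C₂ * torusGraphDist x y))
    (x : Site (n + 1) L) {i j : Fin (n + 1)} (hij : i ≠ j) {R T : ℕ} (hRL : 2 * R ≤ L) (hTL : 2 * T ≤ L) :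
    |W.expectation (fundamentalRep (Fin N)) ((N : ℝ) * β) (wilsonLoop (fundamentalRep (Fin N)) x i j R T)| ≤
      max (N : ℝ) (Real.exp (C₂ / (2 * m) * (2 * Real.log (max (((N : ℝ) ^ 2) ^ m * (4 * C₁)) 1) / C₂) ^ 2)) *
        Real.exp (-(C₂ / (2 * m)) * ((R : ℝ) * T)) := by
  rw [expectation_eq_loopRatio]
  exact robust_slab_criterion hN β W.measurable_total W.exists_abs_total_le hm hloc hWc hC₂ hcov x hij hRL hTL

end QuasiLocal

end Summit.Ventures.YMGap.RobustBall
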